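import Summits.ABC.IUTFork.Repair.RHSlotReachMoverOdd
import HarnessLib

/-!
# R-H ROUND 1 (D-0079, D-0107), rows 8 «heightclass» / 15 «slotreach» — ASSEMBLY of the k2 door at `A = 1`:
# `SlotReachWindow` at `n₀ ≡ 1` (odd residue characteristic under the bad places) ⟹ multi-reach at every packet ⟹ S_H at `settingPrVolSharp`

PROOF-ONLY file (D-0012: 0 definitions, 0 `Prop` facts; abc-iut cell, rung LADDER-ABC:A2.RP → A2.RESCUE.H; seat abc-iut-rp-m2 gen 5 = R-H k2 DESK
hand #8; sequel of `Repair.RHSlotReachMoverOdd` — the donor / active movers at a fibre point). TAKES NO SIDE on [IUTchIII] Cor. 3.12 or on any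
author; every R-H candidate is a HYPOTHESIS; typed ≠ proved; instantiated ≠ endorsed.

* `multiReach_of_slotReachWindow_one` — dictionary `e = ramIdx`, `n₀ ≡ 1`, certified outer radius `p^{λ_x} ≤ ‖z_x‖` (`z_x ∈ log_p 𝒪_x^×`) at every
  place, Θ- and q-coordinates of norms `p^{−mΘ/e}` / `p^{−m_q/e}` at the bad places, `‖t_Θ‖ = 1` off them, `‖t_q‖ ≤ 1`, `p` odd under the bad
  places: `Repair.RHSlotReach.SlotReachWindow` ⟹ abc-iut-w5-d107's hypothesis `hreach` of
  `Thm311.Real.qRegion_subset_thetaHull_settingDHVolSharp_of_multiReach` at EVERY packet `(i+1, p)` — the product of the donor reaches `p^{λ+1}`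
  (`exists_donor_mover_at`) and the active reach `p^{λ − ⌊(mΘ−1)/e⌋}` (`exists_active_mover_at`) dominates `‖t_q‖ = p^{−m_q/e}` EXACTLY WHEN
  the `(w, i)`-clause of the window holds (`⌈1/e⌉ = 1`: `RHSlotReachMoverOdd.neg_one_ediv`); non-bad last slot: trivial movers.
* `qRegion_subset_thetaHull_settingDHVolSharp_of_slotReachWindow_one` (packet) and
  **`exists_qPinned_and_hull_settingPrVolSharp_of_slotReachWindow_one`** — branch C's «`∃ ρ qK, QPinned ∧ PilotKummerCompatHull`» at the
  print-normalised sharp genuine setting (label `0`: abc-iut-w5-d236's trivial movers for integral `t_q`; archimedean packets: abc-iut-w5-d180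
  `…_inl`; packaging: C-cert-1 `Conditional.Antecedent.exists_qPinned_and_hull_iff`) — the `hSHw` binder shape of the window certificates.
Row 8: `RHHeightClassGlue.slotReachWindow_of_hBand` (p460910) + the certificates of `RHHeightClassGlue` §3 + this file ⟹ «`HBand X` ⟹ S_H»
(assembled corollary: the next append). Row 15's general lemma (any `n₀`, `p = 2`) is abc-iut-rp-d3's. HONEST SCOPE: OUR typed sharp containers and
Dupuy–Hilado's typed (Ind2); STRONGER-THAN-PRINT hull reading; nothing about the printed GLOBAL inequality; no table evaluation (k1: abc-iut-rh-num-1).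
[cite: WeilBNT1967, Ch. II §2, Th. 1] [cite: DupuyHilado2025, §3.9, §4.9] [cite: Mochizuki2012, IUTchIII Thm. 3.11 (i) (Ind2) p. 154,
Cor. 3.12 p. 173–174, Step (xi-f) p. 184] [claim: Mochizuki2012, status: disputed] for every IUT locution.
-/

noncomputable section

open Set Metric Function
open scoped Pointwise

namespace Summit.ABC.IUTFork.Repair.RHSlotReachMoverOddAssembly

open RHSlotReachMoverOdd


section Setting

open NumberField IsDedekindDomain Literature.IUT.LogThetaLattice Literature.IUT.LogVolume Literature.NumberTheory.NumberFields
  Literature.NumberTheory.GaloisRepresentations.Ultrametric Summit.ABC.IUTFork.Thm311 Summit.ABC.IUTFork.Thm311.Real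
  Summit.ABC.IUTFork.Cor312 Summit.ABC.IUTFork.Cor312.Setting Summit.ABC.IUTFork.Cor312Vol

variable {F : Type} [Field F] [NumberField F] (X : PilotData F) {logv : PadicLogs F} (hlog : LogvAnalytic logv)
  (M : Type) [Field M] [NumberField M]
  (archPk : ∀ (j : (thetaIndex X).Label) (vQ : (thetaIndex X).VQ), Set ((logShellsDH X logv).Packet j vQ))
  (archSub : ∀ (j : (thetaIndex X).Label) (v : (thetaIndex X).V),
    Set ((logShellsDH X logv).Packet j ((thetaIndex X).over v)))
  (Ψ : ℤ → ∀ v : (thetaIndex X).V, v ∈ (thetaIndex X).Vbad → Set ((logShellsDH X logv).StarPacket v))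
  (act : ℤ → ∀ v : (thetaIndex X).V, v ∈ (thetaIndex X).Vbad →
    (logShellsDH X logv).StarPacket v → Module.End ℚ ((logShellsDH X logv).StarPacket v))
  (Mmod : ℤ → ∀ j : (thetaIndex X).LabelStar, Set ((logShellsDH X logv).GlobalPacket j.1))
  (region : ℤ → ∀ j : (thetaIndex X).LabelStar, FinDivisor M → ∀ vQ : (thetaIndex X).VQ,
    Set ((logShellsDH X logv).Packet j.1 vQ))
  (n : ℤ) {HT : Type} {LogLink : HT → HT → Type} {IsFull : ∀ {s t : HT}, LogLink s t → Prop}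
  (lat : LGPGaussianLogThetaLattice LogLink IsFull)
  {Frd : Type} {IsoF : Frd → Frd → Type} {Ob : Frd → Type} {realify : Frd → Frd} {Strip : Type}
  {IsoS : Strip → Strip → Type} {Mv : ∀ v : (thetaIndex X).V, v ∈ (thetaIndex X).Vbad → Type}
  [∀ v h, Monoid (Mv v h)]
  (sig : GlobalLGPFrobenioidSignature (thetaIndex X).lstar (thetaIndex X).V (· ∈ (thetaIndex X).Vbad)
    Frd IsoF Ob realify Strip IsoS Mv)
  (split : SplittingMonoids Mv) {ObΔ : Type} {N : ∀ v : (thetaIndex X).V, v ∈ (thetaIndex X).Vbad → Type}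
  [∀ v h, Monoid (N v h)] (qData : QPilotData ObΔ N)
  (tq : ∀ (pp : Nat.Primes) (x : (thetaIndex X).Fibre (.inr pp)), haveI : Fact (pp : ℕ).Prime := ⟨pp.2⟩; kOf X pp.1 x)
  (t : ∀ (pp : Nat.Primes) (_ : Fin X.lstar) (x : (thetaIndex X).Fibre (.inr pp)),
    haveI : Fact (pp : ℕ).Prime := ⟨pp.2⟩; kOf X pp.1 x)
  (htq0 : ∀ pp x, tq pp x ≠ 0)
  (htq1 : ∀ (pp : Nat.Primes) (x : (thetaIndex X).Fibre (.inr pp)),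
    haveI : Fact (pp : ℕ).Prime := ⟨pp.2⟩; placeOf X pp.1 x ∉ X.S → ‖tq pp x‖ = 1)
  (col : ℤ → Column (logShellsDH X logv))
  -- the numeric dictionary of `SlotReachWindow`
  (e n₀ : ∀ pp : Nat.Primes, (thetaIndex X).Fibre (.inr pp) → ℕ)
  (lam : ∀ pp : Nat.Primes, (thetaIndex X).Fibre (.inr pp) → ℝ)
  (mΘ : ∀ pp : Nat.Primes, Fin (thetaIndex X).lstar → (thetaIndex X).Fibre (.inr pp) → ℤ)
  (mq : ∀ pp : Nat.Primes, (thetaIndex X).Fibre (.inr pp) → ℤ)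

/-- **MULTI-REACH FROM THE SLOT-REACH WINDOW at `n₀ ≡ 1`, odd residue characteristic under the bad places.** Dictionary: `e = ramIdx`,
`n₀ ≡ 1`, a certified outer radius `p^{λ_x} ≤ ‖z_x‖` (`z_x ∈ log_p 𝒪_x^×`) at EVERY place, Θ- and q-coordinates of norms `p^{−mΘ/e}`,
`p^{−m_q/e}` at the bad places (`‖t_Θ‖ = 1` off the bad places, `‖t_q‖ ≤ 1` everywhere). THEN `SlotReachWindow` gives abc-iut-w5-d107's
multi-reach hypothesis `hreach` of `Thm311.Real.qRegion_subset_thetaHull_settingDHVolSharp_of_multiReach` at every packet `(i+1, p)`: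
donor slots by `exists_donor_mover_at` (reach `p^{λ+1}`), the active slot by `exists_active_mover_at` (reach `p^{λ − ⌊(mΘ−1)/e⌋}`), and the
window clause is exactly «product of the reaches ≥ ‖t_q‖». (Row 15's general lemma, any `n₀` and `p = 2`, is abc-iut-rp-d3's; this is the
case row 8 «heightclass» needs.) [cite: WeilBNT1967, Ch. II §2, Th. 1] [cite: DupuyHilado2025, §3.9, §4.9] [claim: Mochizuki2012, status: disputed] -/
theorem multiReach_of_slotReachWindow_one
    (hodd : ∀ (pp : Nat.Primes) (w : (thetaIndex X).Fibre (.inr pp)), haveI : Fact (pp : ℕ).Prime := ⟨pp.2⟩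
      placeOf X pp.1 w ∈ X.S → 2 < (pp : ℕ))
    (htqle : ∀ pp x, ‖tq pp x‖ ≤ 1)
    (he : ∀ (pp : Nat.Primes) (x : (thetaIndex X).Fibre (.inr pp)), haveI : Fact (pp : ℕ).Prime := ⟨pp.2⟩
      e pp x = ramIdx F (placeOf X pp.1 x))
    (hn₀ : ∀ pp x, n₀ pp x = 1)
    (hrad : ∀ (pp : Nat.Primes) (x : (thetaIndex X).Fibre (.inr pp)), haveI : Fact (pp : ℕ).Prime := ⟨pp.2⟩
      ∃ z ∈ (logUnits (kOf X pp.1 x) : Set (kOf X pp.1 x)), ((pp : ℕ) : ℝ) ^ (lam pp x) ≤ ‖z‖)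
    (ht1 : ∀ (pp : Nat.Primes) (i : Fin X.lstar) (x : (thetaIndex X).Fibre (.inr pp)),
      haveI : Fact (pp : ℕ).Prime := ⟨pp.2⟩; placeOf X pp.1 x ∉ X.S → ‖t pp i x‖ = 1)
    (hΘ : ∀ (pp : Nat.Primes) (i : Fin X.lstar) (w : (thetaIndex X).Fibre (.inr pp)), haveI : Fact (pp : ℕ).Prime := ⟨pp.2⟩
      placeOf X pp.1 w ∈ X.S → ‖t pp i w‖ = ((pp : ℕ) : ℝ) ^ (-(mΘ pp i w : ℝ) / (ramIdx F (placeOf X pp.1 w) : ℝ)))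
    (hq : ∀ (pp : Nat.Primes) (w : (thetaIndex X).Fibre (.inr pp)), haveI : Fact (pp : ℕ).Prime := ⟨pp.2⟩
      placeOf X pp.1 w ∈ X.S → ‖tq pp w‖ = ((pp : ℕ) : ℝ) ^ (-(mq pp w : ℝ) / (ramIdx F (placeOf X pp.1 w) : ℝ)))
    (hH : RHSlotReach.SlotReachWindow (thetaIndex X).lstar (fun pp => (thetaIndex X).Fibre (.inr pp))
      (fun pp w => haveI : Fact (pp : ℕ).Prime := ⟨pp.2⟩; placeOf X pp.1 w ∈ X.S) e n₀ lam mΘ mq)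
    (pp : Nat.Primes) (i : Fin (thetaIndex X).lstar)
    (ev : (thetaIndex X).Caps (Setting.labelSucc i) → (thetaIndex X).Fibre (.inr pp)) :
    haveI : Fact (pp : ℕ).Prime := ⟨pp.2⟩
    ∃ g : (thetaIndex X).Caps (Setting.labelSucc i) → ∀ x : (thetaIndex X).Fibre (.inr pp),
        (logShellsDH X logv).carrier x.1 ≃ₗ[ℚ] (logShellsDH X logv).carrier x.1,
      (∀ a x, g a x ∈ (logShellsDH X logv).ism x.1) ∧
      ∃ y : ∀ a, kOf X pp.1 (ev a), (∀ a, ‖y a‖ ≤ 1) ∧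
        ‖tq pp (ev (Fin.last _))‖ ≤ ∏ a, ‖(presAt X hlog pp).φ (ev a) (g a (ev a) (((presAt X hlog pp).φ (ev a)).symm
          ((if a = Fin.last _ then t pp i (ev a) else 1) * y a)))‖ := by
  haveI : Fact (pp : ℕ).Prime := ⟨pp.2⟩
  classical
  by_cases hw : placeOf X pp.1 (ev (Fin.last _)) ∈ X.S
  · -- BAD last slot
    have hp2 : 2 < (pp : ℕ) := hodd pp _ hw
    have hp0 : (0 : ℝ) < ((pp : ℕ) : ℝ) := by exact_mod_cast pp.2.pos
    have hp1 : (1 : ℝ) ≤ ((pp : ℕ) : ℝ) := by exact_mod_cast pp.2.one_lt.le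
    -- donor movers at every place of the fibre
    have hdon := fun x : (thetaIndex X).Fibre (.inr pp) =>
      exists_donor_mover_at (X := X) (hlog := hlog) (lam := lam) pp hp2 x (hrad pp x)
    choose gD hgD yD hyD hD using hdon
    -- active movers at every bad place of the fibre (trivial elsewhere)
    have hact : ∀ x : (thetaIndex X).Fibre (.inr pp), ∃ g ∈ ismDH logv x.1, ∃ y : kOf X pp.1 x, ‖y‖ ≤ 1 ∧
        (placeOf X pp.1 x ∈ X.S → ((pp : ℕ) : ℝ) ^ (lam pp x - (((mΘ pp i x - 1) / (ramIdx F (placeOf X pp.1 x) : ℤ) : ℤ) : ℝ)) ≤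
          ‖(presAt X hlog pp).φ x (g (((presAt X hlog pp).φ x).symm (t pp i x * y)))‖) := by
      intro x
      by_cases hx : placeOf X pp.1 x ∈ X.S
      · obtain ⟨g, hg, y, hy, h⟩ :=
          exists_active_mover_at (X := X) (hlog := hlog) (t := t) (lam := lam) (mΘ := mΘ) pp hp2 i x (hrad pp x) (hΘ pp i x hx)
        exact ⟨g, hg, y, hy, fun _ => h⟩
      · exact ⟨LinearEquiv.refl ℚ _, refl_mem_ismDH logv x.1, 1, norm_one.le, fun h => absurd h hx⟩
    choose gA hgA yA hyA hA using hact
    -- the window clause at `(w, i)` with the donors `ev ∘ castSucc`, at `n₀ = 1`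
    have hcl : (((mΘ pp i (ev (Fin.last _)) - 1) / (ramIdx F (placeOf X pp.1 (ev (Fin.last _))) : ℤ) : ℤ) : ℝ) ≤
        (mq pp (ev (Fin.last _)) : ℝ) / (ramIdx F (placeOf X pp.1 (ev (Fin.last _))) : ℝ) + lam pp (ev (Fin.last _)) +
          Finset.sum Finset.univ (fun b : Fin (Setting.labelSucc i : ℕ) => lam pp (ev (Fin.castSucc b)) + 1) := by
      have h := hH pp i (ev (Fin.last _)) hw (fun b => ev (Fin.castSucc b))
      have hterm : ∀ x : (thetaIndex X).Fibre (.inr pp),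
          ((-((-(n₀ pp x : ℤ)) / (e pp x : ℤ)) : ℤ) : ℝ) = 1 := by
        intro x
        have h1 : (1 : ℤ) ≤ (e pp x : ℤ) := by
          rw [he]; exact_mod_cast Nat.one_le_iff_ne_zero.2 (ramIdx_ne_zero F _)
        rw [hn₀, Nat.cast_one, neg_one_ediv h1, neg_neg, Int.cast_one]
      simp only [hterm] at h
      rw [hn₀, he, Nat.cast_one] at h
      exact h
    refine ⟨fun a x => if a = Fin.last _ then gA x else gD x, fun a x => ?_,
      fun a => if a = Fin.last _ then yA (ev a) else yD (ev a), fun a => ?_, ?_⟩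
    · dsimp only; split_ifs; exacts [hgA x, hgD x]
    · dsimp only; split_ifs; exacts [hyA (ev a), hyD (ev a)]
    · -- lower bounds slot by slot
      set BND : (thetaIndex X).Caps (Setting.labelSucc i) → ℝ := fun a =>
        if a = Fin.last _ then
          ((pp : ℕ) : ℝ) ^ (lam pp (ev a) - (((mΘ pp i (ev a) - 1) / (ramIdx F (placeOf X pp.1 (ev a)) : ℤ) : ℤ) : ℝ))
        else ((pp : ℕ) : ℝ) ^ (lam pp (ev a) + 1) with hBND
      refine le_trans (b := ∏ a, BND a) ?_ (Finset.prod_le_prod (fun a _ => ?_) (fun a _ => ?_))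
      · -- `‖t_q‖ ≤ ∏ BND`: the window clause
        rw [Fin.prod_univ_castSucc]
        simp only [hBND, Fin.castSucc_ne_last, if_false, if_true]
        rw [← Real.rpow_sum_of_pos hp0, ← Real.rpow_add hp0, hq pp _ hw]
        refine Real.rpow_le_rpow_of_exponent_le hp1 ?_
        rw [neg_div]
        linarith
      · simp only [hBND]
        split_ifs <;> exact Real.rpow_nonneg hp0.le _
      · simp only [hBND]
        by_cases ha : a = Fin.last _
        · subst ha
          simp only [if_true]
          exact hA _ hw
        · simp only [ha, if_false]
          exact hD (ev a)
  · -- NON-BAD last slot: trivial movers, `‖t_q‖ ≤ 1 = ‖t_Θ‖`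
    refine ⟨fun _ x => LinearEquiv.refl ℚ _, fun _ x => (logShellsDH X logv).one_mem_ism x.1, fun _ => 1,
      fun _ => norm_one.le, ?_⟩
    have hprod : ∏ a : (thetaIndex X).Caps (Setting.labelSucc i),
        ‖(presAt X hlog pp).φ (ev a) ((LinearEquiv.refl ℚ _)
          (((presAt X hlog pp).φ (ev a)).symm ((if a = Fin.last _ then t pp i (ev a) else 1) * (1 : kOf X pp.1 (ev a)))))‖ = 1 := by
      refine Finset.prod_eq_one fun a _ => ?_
      rw [mul_one, LinearEquiv.refl_apply, LinearEquiv.apply_symm_apply]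
      split_ifs with ha
      · subst ha; exact ht1 pp i _ hw
      · exact (norm_one (α := kOf X pp.1 (ev a)))
    rw [hprod]
    exact htqle pp _

/-- **PACKET LEVEL: `qRegion ⊆ ⁿ˒°𝒰_{i+1,p}` at the sharp DH setting from `SlotReachWindow` at `n₀ ≡ 1`** (abc-iut-w5-d107's
`qRegion_subset_thetaHull_settingDHVolSharp_of_multiReach` fed by `multiReach_of_slotReachWindow_one`). [cite: DupuyHilado2025, §3.9, §4.9]
[claim: Mochizuki2012, status: disputed] -/
theorem qRegion_subset_thetaHull_settingDHVolSharp_of_slotReachWindow_one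
    (hodd : ∀ (pp : Nat.Primes) (w : (thetaIndex X).Fibre (.inr pp)), haveI : Fact (pp : ℕ).Prime := ⟨pp.2⟩
      placeOf X pp.1 w ∈ X.S → 2 < (pp : ℕ))
    (htqle : ∀ pp x, ‖tq pp x‖ ≤ 1)
    (he : ∀ (pp : Nat.Primes) (x : (thetaIndex X).Fibre (.inr pp)), haveI : Fact (pp : ℕ).Prime := ⟨pp.2⟩
      e pp x = ramIdx F (placeOf X pp.1 x))
    (hn₀ : ∀ pp x, n₀ pp x = 1)
    (hrad : ∀ (pp : Nat.Primes) (x : (thetaIndex X).Fibre (.inr pp)), haveI : Fact (pp : ℕ).Prime := ⟨pp.2⟩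
      ∃ z ∈ (logUnits (kOf X pp.1 x) : Set (kOf X pp.1 x)), ((pp : ℕ) : ℝ) ^ (lam pp x) ≤ ‖z‖)
    (ht1 : ∀ (pp : Nat.Primes) (i : Fin X.lstar) (x : (thetaIndex X).Fibre (.inr pp)),
      haveI : Fact (pp : ℕ).Prime := ⟨pp.2⟩; placeOf X pp.1 x ∉ X.S → ‖t pp i x‖ = 1)
    (hΘ : ∀ (pp : Nat.Primes) (i : Fin X.lstar) (w : (thetaIndex X).Fibre (.inr pp)), haveI : Fact (pp : ℕ).Prime := ⟨pp.2⟩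
      placeOf X pp.1 w ∈ X.S → ‖t pp i w‖ = ((pp : ℕ) : ℝ) ^ (-(mΘ pp i w : ℝ) / (ramIdx F (placeOf X pp.1 w) : ℝ)))
    (hq : ∀ (pp : Nat.Primes) (w : (thetaIndex X).Fibre (.inr pp)), haveI : Fact (pp : ℕ).Prime := ⟨pp.2⟩
      placeOf X pp.1 w ∈ X.S → ‖tq pp w‖ = ((pp : ℕ) : ℝ) ^ (-(mq pp w : ℝ) / (ramIdx F (placeOf X pp.1 w) : ℝ)))
    (hH : RHSlotReach.SlotReachWindow (thetaIndex X).lstar (fun pp => (thetaIndex X).Fibre (.inr pp))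
      (fun pp w => haveI : Fact (pp : ℕ).Prime := ⟨pp.2⟩; placeOf X pp.1 w ∈ X.S) e n₀ lam mΘ mq)
    (pp : Nat.Primes) (i : Fin (thetaIndex X).lstar) :
    (settingDHVolSharp X hlog M archPk archSub Ψ act Mmod region n lat sig split qData tq t htq0 htq1).qRegion
        (Setting.labelSucc i) (.inr pp) ⊆
      (settingDHVolSharp X hlog M archPk archSub Ψ act Mmod region n lat sig split qData tq t htq0 htq1).thetaHull
        (Setting.labelSucc i) (.inr pp) :=
  qRegion_subset_thetaHull_settingDHVolSharp_of_multiReach X hlog M archPk archSub Ψ act Mmod region n lat sig split qData tq t htq0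
    htq1 pp i (multiReach_of_slotReachWindow_one (X := X) (hlog := hlog) (tq := tq) (t := t) (e := e) (n₀ := n₀) (lam := lam)
      (mΘ := mΘ) (mq := mq) hodd htqle he hn₀ hrad ht1 hΘ hq hH pp i)

/-- **S_H LEVEL: branch C's hull-level antecedent «`∃ ρ qK, QPinned ∧ PilotKummerCompatHull`» at the print-normalised sharp genuine setting
`settingPrVolSharp` from `SlotReachWindow` at `n₀ ≡ 1`** (odd residue characteristic under the bad places; integral `t_q`; any columns). Labels of
`𝔽_l^⋇`: `qRegion_subset_thetaHull_settingDHVolSharp_of_slotReachWindow_one`; label `0`: abc-iut-w5-d236's trivial movers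
(`exists_mover_of_norm_le`, `t_{Θ,0} := 1`); archimedean packets: abc-iut-w5-d180 `…_inl`; packaging: C-cert-1's
`Conditional.Antecedent.exists_qPinned_and_hull_iff`. This is the `hSHw` binder shape of the window certificates
(`Conditional.abc_of_SH_v10K_window` ff.) at `X := pilotDataOfK D K`. [cite: DupuyHilado2025, §3.9, §4.9]
[cite: Mochizuki2012, IUTchIII Cor. 3.12 p. 173–174, Step (xi-f) p. 184] [claim: Mochizuki2012, status: disputed] -/
theorem exists_qPinned_and_hull_settingPrVolSharp_of_slotReachWindow_one
    (hodd : ∀ (pp : Nat.Primes) (w : (thetaIndex X).Fibre (.inr pp)), haveI : Fact (pp : ℕ).Prime := ⟨pp.2⟩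
      placeOf X pp.1 w ∈ X.S → 2 < (pp : ℕ))
    (htqle : ∀ pp x, ‖tq pp x‖ ≤ 1)
    (he : ∀ (pp : Nat.Primes) (x : (thetaIndex X).Fibre (.inr pp)), haveI : Fact (pp : ℕ).Prime := ⟨pp.2⟩
      e pp x = ramIdx F (placeOf X pp.1 x))
    (hn₀ : ∀ pp x, n₀ pp x = 1)
    (hrad : ∀ (pp : Nat.Primes) (x : (thetaIndex X).Fibre (.inr pp)), haveI : Fact (pp : ℕ).Prime := ⟨pp.2⟩
      ∃ z ∈ (logUnits (kOf X pp.1 x) : Set (kOf X pp.1 x)), ((pp : ℕ) : ℝ) ^ (lam pp x) ≤ ‖z‖)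
    (ht1 : ∀ (pp : Nat.Primes) (i : Fin X.lstar) (x : (thetaIndex X).Fibre (.inr pp)),
      haveI : Fact (pp : ℕ).Prime := ⟨pp.2⟩; placeOf X pp.1 x ∉ X.S → ‖t pp i x‖ = 1)
    (hΘ : ∀ (pp : Nat.Primes) (i : Fin X.lstar) (w : (thetaIndex X).Fibre (.inr pp)), haveI : Fact (pp : ℕ).Prime := ⟨pp.2⟩
      placeOf X pp.1 w ∈ X.S → ‖t pp i w‖ = ((pp : ℕ) : ℝ) ^ (-(mΘ pp i w : ℝ) / (ramIdx F (placeOf X pp.1 w) : ℝ)))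
    (hq : ∀ (pp : Nat.Primes) (w : (thetaIndex X).Fibre (.inr pp)), haveI : Fact (pp : ℕ).Prime := ⟨pp.2⟩
      placeOf X pp.1 w ∈ X.S → ‖tq pp w‖ = ((pp : ℕ) : ℝ) ^ (-(mq pp w : ℝ) / (ramIdx F (placeOf X pp.1 w) : ℝ)))
    (hH : RHSlotReach.SlotReachWindow (thetaIndex X).lstar (fun pp => (thetaIndex X).Fibre (.inr pp))
      (fun pp w => haveI : Fact (pp : ℕ).Prime := ⟨pp.2⟩; placeOf X pp.1 w ∈ X.S) e n₀ lam mΘ mq) :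
    ∃ (ρ' : (∀ v : (thetaIndex X).V, v ∈ (thetaIndex X).Vbad → Set ((logShellsDH X logv).StarPacket v)) →
          ∀ (j : (thetaIndex X).Label) (vQ : (thetaIndex X).VQ), Set ((logShellsDH X logv).Packet j vQ))
        (qK : ∀ v : (thetaIndex X).V, v ∈ (thetaIndex X).Vbad → Set ((logShellsDH X logv).StarPacket v)),
        QPinned ({ toSituation := situationPrVol X hlog M archPk archSub Ψ act Mmod region, col := col } :
            LatticeSituation (thetaIndex X))
          (settingPrVolSharp X hlog M archPk archSub Ψ act Mmod region n lat sig split qData tq t htq0 htq1) ρ' qK ∧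
        PilotKummerCompatHull ({ toSituation := situationPrVol X hlog M archPk archSub Ψ act Mmod region, col := col } :
            LatticeSituation (thetaIndex X))
          (settingPrVolSharp X hlog M archPk archSub Ψ act Mmod region n lat sig split qData tq t htq0 htq1) ρ' qK := by
  refine (Conditional.Antecedent.exists_qPinned_and_hull_iff
    ({ toSituation := situationPrVol X hlog M archPk archSub Ψ act Mmod region, col := col } : LatticeSituation (thetaIndex X))
    (settingPrVolSharp X hlog M archPk archSub Ψ act Mmod region n lat sig split qData tq t htq0 htq1)).2 fun j vQ => ?_
  haveI hne : ∀ pp : Nat.Primes, Fact (pp : ℕ).Prime := fun pp => ⟨pp.2⟩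
  by_cases hj : 0 < (j : ℕ)
  · -- a label of `𝔽_l^⋇`: multi-reach at every packet over every prime
    have hj' : j = labelSucc ⟨(j : ℕ) - 1, by have := j.2; simp only [thetaIndex] at this ⊢; omega⟩ := by
      ext; simp only [labelSucc, Fin.val_succ]; omega
    rw [hj']
    cases vQ with
    | inl u =>
      exact qRegion_subset_thetaHull_settingDHVolSharp_inl X hlog M archPk archSub Ψ act Mmod region n lat sig split qData tq t htq0
        htq1 (labelSucc _) u
    | inr pp =>
      exact qRegion_subset_thetaHull_settingDHVolSharp_of_slotReachWindow_one X hlog M archPk archSub Ψ act Mmod region n lat sig split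
        qData tq t htq0 htq1 e n₀ lam mΘ mq hodd htqle he hn₀ hrad ht1 hΘ hq hH pp _
  · -- the label `0`: the Θ-idele is `1`, trivial movers for integral `t_q`
    refine qRegion_subset_thetaHull_settingDHVolSharp_of_movers X hlog M archPk archSub Ψ act Mmod region n lat sig split qData tq t
      htq0 htq1 j vQ fun pp x => exists_mover_of_norm_le X hlog tq t pp j x ?_
    unfold labelIdele
    rw [dif_neg hj, norm_one]
    exact htqle pp x

end Setting

end Summit.ABC.IUTFork.Repair.RHSlotReachMoverOddAssembly

end
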